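import Summits.FinalStateConjecture.FinalStateConjecture.Theorems.EIHFluxBalanceInertialRecessionVirialColdLimit

/-!
# Route EIHFluxBalance — crux `InertialRecession`, abstract endgame for general `N`:
# preparations for LEMMA C (ii) — energy smoothness, `K ≲ spread²`

Helper file for the crux `stmt-FinalStateConjecture-10166` (virial route; `InertialRecession_seat0_session8_note.md` §A).
Mathlib-only:

* `norm_lorentzMomentum_sub_le` — `v ↦ γ(v) v` is `2Γ⁴`-Lipschitz on the ball `‖v‖ ≤ k` (`Γ = γ(k)`), pure algebra;
* `energy_smoothness` — `E(p) − E(q) − ⟨q/E(q), p − q⟩ ≤ ‖p − q‖²/(2E(q))` for `E(p) = √(M² + ‖p‖²)`;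
* `internalEnergy_le'` — the upper energy comparison `K ≤ (2Γ⁸/M_B) Σⱼₗ MⱼMₗ‖vⱼ − vₗ‖²`, the converse of `internalEnergy_ge`
  (registered one-line form `internalEnergy_le`). With `mass_mul_norm_sub_coldVelocity_sq_le` this is `K ≍ spread²`.
-/

noncomputable section

open Finset Filter Topology MeasureTheory intervalIntegral Set

namespace Summit.FinalStateConjecture.FinalStateConjecture.Theorems.SublinearIsFree.Virial

open Literature.Geometry.Lorentzian

/-! ### Lipschitz bound for `v ↦ γ(v) v` -/

/-- Difference of Lorentz factors: `|γ(a) − γ(b)| ≤ k Γ⁴ |‖a‖ − ‖b‖|` on the ball `‖·‖ ≤ k < 1`, `Γ = γ(k)`. Pure algebra: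
`γ_a − γ_b = (‖a‖² − ‖b‖²) γ_a² γ_b² / (γ_a + γ_b)`. [folklore] -/
theorem abs_lorentzFactor_sub_le {a b : E3} {k : ℝ} (hk : k < 1) (ha : ‖a‖ ≤ k) (hb : ‖b‖ ≤ k) :
    |(√(1 - ‖a‖ ^ 2))⁻¹ - (√(1 - ‖b‖ ^ 2))⁻¹| ≤ k * ((√(1 - k ^ 2))⁻¹) ^ 4 * |‖a‖ - ‖b‖| := by
  have hk0 : 0 ≤ k := (norm_nonneg a).trans ha
  have hk2 : 0 < 1 - k ^ 2 := by nlinarith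
  have ha2 : 0 < 1 - ‖a‖ ^ 2 := by nlinarith [norm_nonneg a]
  have hb2 : 0 < 1 - ‖b‖ ^ 2 := by nlinarith [norm_nonneg b]
  set γa : ℝ := (√(1 - ‖a‖ ^ 2))⁻¹ with hγa
  set γb : ℝ := (√(1 - ‖b‖ ^ 2))⁻¹ with hγb
  set Γ : ℝ := (√(1 - k ^ 2))⁻¹ with hΓ
  have hsa : 0 < √(1 - ‖a‖ ^ 2) := Real.sqrt_pos.mpr ha2
  have hsb : 0 < √(1 - ‖b‖ ^ 2) := Real.sqrt_pos.mpr hb2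
  have hsk : 0 < √(1 - k ^ 2) := Real.sqrt_pos.mpr hk2
  have hγa0 : 0 < γa := inv_pos.mpr hsa
  have hγb0 : 0 < γb := inv_pos.mpr hsb
  have hΓ0 : 0 < Γ := inv_pos.mpr hsk
  -- squares
  have hγa2 : γa ^ 2 = (1 - ‖a‖ ^ 2)⁻¹ := by rw [hγa, inv_pow, Real.sq_sqrt ha2.le]
  have hγb2 : γb ^ 2 = (1 - ‖b‖ ^ 2)⁻¹ := by rw [hγb, inv_pow, Real.sq_sqrt hb2.le]
  have hΓ2 : Γ ^ 2 = (1 - k ^ 2)⁻¹ := by rw [hΓ, inv_pow, Real.sq_sqrt hk2.le]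
  -- `γa, γb ≤ Γ`
  have hle : ∀ {x : ℝ}, 0 ≤ x → x ≤ k → (√(1 - x ^ 2))⁻¹ ≤ Γ := by
    intro x hx hxk
    rw [hΓ]
    have hx2 : 0 < 1 - x ^ 2 := by nlinarith
    exact inv_anti₀ hsk (Real.sqrt_le_sqrt (by nlinarith))
  have hγaΓ : γa ≤ Γ := hle (norm_nonneg a) ha
  have hγbΓ : γb ≤ Γ := hle (norm_nonneg b) hb
  -- the identity `(γa − γb)(γa + γb) = (‖a‖² − ‖b‖²) γa² γb²`
  have hid : (γa - γb) * (γa + γb) = (‖a‖ ^ 2 - ‖b‖ ^ 2) * (γa ^ 2 * γb ^ 2) := by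
    have h1 : γa ^ 2 * (1 - ‖a‖ ^ 2) = 1 := by rw [hγa2, inv_mul_cancel₀ ha2.ne']
    have h2 : γb ^ 2 * (1 - ‖b‖ ^ 2) = 1 := by rw [hγb2, inv_mul_cancel₀ hb2.ne']
    nlinarith [h1, h2]
  have hsum : 0 < γa + γb := by linarith
  have heq : γa - γb = (‖a‖ ^ 2 - ‖b‖ ^ 2) * (γa ^ 2 * γb ^ 2) / (γa + γb) := by
    rw [eq_div_iff hsum.ne']; exact hid
  rw [heq, abs_div, abs_of_pos hsum, abs_mul, abs_of_pos (by positivity : 0 < γa ^ 2 * γb ^ 2)]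
  -- `|‖a‖² − ‖b‖²| = |‖a‖ − ‖b‖| (‖a‖ + ‖b‖) ≤ 2k |‖a‖ − ‖b‖|`, `γa²γb² ≤ Γ⁴`, `γa + γb ≥ 2`
  have h1 : |‖a‖ ^ 2 - ‖b‖ ^ 2| = |‖a‖ - ‖b‖| * (‖a‖ + ‖b‖) := by
    rw [sq_sub_sq, abs_mul, abs_of_nonneg (by positivity : 0 ≤ ‖a‖ + ‖b‖), mul_comm]
  rw [h1]
  have h1a : 1 ≤ γa := by
    rw [hγa]; exact one_le_inv_sqrt_one_sub_sq' (by nlinarith [norm_nonneg a])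
  have h1b : 1 ≤ γb := by
    rw [hγb]; exact one_le_inv_sqrt_one_sub_sq' (by nlinarith [norm_nonneg b])
  have h2 : 2 ≤ γa + γb := by linarith
  have hprod : γa ^ 2 * γb ^ 2 ≤ Γ ^ 4 := by
    have : Γ ^ 4 = Γ ^ 2 * Γ ^ 2 := by ring
    rw [this]
    exact mul_le_mul (pow_le_pow_left₀ hγa0.le hγaΓ 2) (pow_le_pow_left₀ hγb0.le hγbΓ 2) (by positivity) (by positivity)
  have habs : 0 ≤ |‖a‖ - ‖b‖| := abs_nonneg _
  rw [div_le_iff₀ hsum]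
  have hab : ‖a‖ + ‖b‖ ≤ 2 * k := by linarith
  calc |‖a‖ - ‖b‖| * (‖a‖ + ‖b‖) * (γa ^ 2 * γb ^ 2) ≤ |‖a‖ - ‖b‖| * (2 * k) * Γ ^ 4 := by
        gcongr
    _ = k * Γ ^ 4 * |‖a‖ - ‖b‖| * 2 := by ring
    _ ≤ k * Γ ^ 4 * |‖a‖ - ‖b‖| * (γa + γb) := by gcongr

/-- **`v ↦ γ(v) v` is `2Γ⁴`-Lipschitz on the closed ball of radius `k < 1`** (`Γ = γ(k)`):
`‖γ(a)a − γ(b)b‖ ≤ 2Γ⁴‖a − b‖`. (Write `γ_a a − γ_b b = γ_a (a − b) + (γ_a − γ_b) b`.) [folklore] -/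
theorem norm_lorentzMomentum_sub_le {a b : E3} {k : ℝ} (hk : k < 1) (ha : ‖a‖ ≤ k) (hb : ‖b‖ ≤ k) :
    ‖(√(1 - ‖a‖ ^ 2))⁻¹ • a - (√(1 - ‖b‖ ^ 2))⁻¹ • b‖ ≤ 2 * ((√(1 - k ^ 2))⁻¹) ^ 4 * ‖a - b‖ := by
  have hk0 : 0 ≤ k := (norm_nonneg a).trans ha
  have hk2 : 0 < 1 - k ^ 2 := by nlinarith
  have ha2 : 0 < 1 - ‖a‖ ^ 2 := by nlinarith [norm_nonneg a]
  set γa : ℝ := (√(1 - ‖a‖ ^ 2))⁻¹ with hγa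
  set γb : ℝ := (√(1 - ‖b‖ ^ 2))⁻¹ with hγb
  set Γ : ℝ := (√(1 - k ^ 2))⁻¹ with hΓ
  have hsa : 0 < √(1 - ‖a‖ ^ 2) := Real.sqrt_pos.mpr ha2
  have hsk : 0 < √(1 - k ^ 2) := Real.sqrt_pos.mpr hk2
  have hγa0 : 0 < γa := inv_pos.mpr hsa
  have hΓ1 : 1 ≤ Γ := by rw [hΓ]; exact one_le_inv_sqrt_one_sub_sq' (by nlinarith)
  have hγaΓ : γa ≤ Γ := by
    rw [hγa, hΓ]; exact inv_anti₀ hsk (Real.sqrt_le_sqrt (by nlinarith [norm_nonneg a]))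
  have hsplit : γa • a - γb • b = γa • (a - b) + (γa - γb) • b := by
    rw [smul_sub, sub_smul]; abel
  rw [hsplit]
  have hdiff := abs_lorentzFactor_sub_le hk ha hb
  calc ‖γa • (a - b) + (γa - γb) • b‖ ≤ ‖γa • (a - b)‖ + ‖(γa - γb) • b‖ := norm_add_le _ _
    _ = γa * ‖a - b‖ + |γa - γb| * ‖b‖ := by
        rw [norm_smul, norm_smul, Real.norm_eq_abs, Real.norm_eq_abs, abs_of_pos hγa0]
    _ ≤ Γ * ‖a - b‖ + (k * Γ ^ 4 * |‖a‖ - ‖b‖|) * k := by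
        gcongr
    _ ≤ Γ * ‖a - b‖ + k * Γ ^ 4 * ‖a - b‖ * k := by
        gcongr
        exact abs_norm_sub_norm_le a b
    _ ≤ 2 * Γ ^ 4 * ‖a - b‖ := by
        have hΓ4 : Γ ≤ Γ ^ 4 := by
          calc Γ = Γ ^ 1 := (pow_one Γ).symm
            _ ≤ Γ ^ 4 := pow_le_pow_right₀ hΓ1 (by norm_num)
        have hk1 : k * k ≤ 1 := by nlinarith
        have hn : 0 ≤ ‖a - b‖ := norm_nonneg _
        have hΓ40 : 0 ≤ Γ ^ 4 := by positivity
        nlinarith [mul_le_mul_of_nonneg_right hΓ4 hn, mul_nonneg hΓ40 hn]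

/-! ### The upper energy comparison `K ≲ spread²` -/

/-- Smoothness of `E(p) = √(M² + ‖p‖²)`: `E(p) − E(q) − ⟨q/E(q), p − q⟩ ≤ ‖p − q‖²/(2 E(q))`. (Square both sides:
`E(p)² = E(q)² + 2⟨q, p − q⟩ + ‖p − q‖² = E(q)² + 2E(q)x` with `x` the sum of the two correction terms.) [folklore] -/
theorem energy_smoothness {M : ℝ} (hM : M ≠ 0) (p q : E3) :
    √(M ^ 2 + ‖p‖ ^ 2) - √(M ^ 2 + ‖q‖ ^ 2) - inner ℝ ((√(M ^ 2 + ‖q‖ ^ 2))⁻¹ • q) (p - q) ≤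
      ‖p - q‖ ^ 2 / (2 * √(M ^ 2 + ‖q‖ ^ 2)) := by
  set Ep : ℝ := √(M ^ 2 + ‖p‖ ^ 2) with hEp
  set Eq : ℝ := √(M ^ 2 + ‖q‖ ^ 2) with hEq
  have hM2 : 0 < M ^ 2 := by positivity
  have hq2 : 0 < M ^ 2 + ‖q‖ ^ 2 := by positivity
  have hp2 : 0 ≤ M ^ 2 + ‖p‖ ^ 2 := by positivity
  have hEq0 : 0 < Eq := Real.sqrt_pos.mpr hq2
  have hEp0 : 0 ≤ Ep := Real.sqrt_nonneg _
  have hEq2 : Eq ^ 2 = M ^ 2 + ‖q‖ ^ 2 := Real.sq_sqrt hq2.le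
  have hEp2 : Ep ^ 2 = M ^ 2 + ‖p‖ ^ 2 := Real.sq_sqrt hp2
  -- `x := (⟨q, p − q⟩ + ‖p − q‖²/2)/Eq`; claim `Ep ≤ Eq + x`
  set x : ℝ := (inner ℝ q (p - q) + ‖p - q‖ ^ 2 / 2) / Eq with hx
  have hinner : inner ℝ ((√(M ^ 2 + ‖q‖ ^ 2))⁻¹ • q) (p - q) = inner ℝ q (p - q) / Eq := by
    rw [real_inner_smul_left, ← hEq, div_eq_inv_mul]
  rw [hinner]
  -- reduce to `Ep ≤ Eq + x`
  suffices h : Ep ≤ Eq + x by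
    have : Eq + x = Eq + inner ℝ q (p - q) / Eq + ‖p - q‖ ^ 2 / (2 * Eq) := by
      rw [hx]; field_simp; ring
    linarith
  -- expansion of `‖p‖²`
  have hexp : ‖p‖ ^ 2 = ‖q‖ ^ 2 + 2 * inner ℝ q (p - q) + ‖p - q‖ ^ 2 := by
    have : p = q + (p - q) := by abel
    conv_lhs => rw [this]
    rw [← real_inner_self_eq_norm_sq, ← real_inner_self_eq_norm_sq, ← real_inner_self_eq_norm_sq (p - q)]
    rw [inner_add_left, inner_add_right, inner_add_right, real_inner_comm (p - q) q]
    ring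
  have hkey : Ep ^ 2 = Eq ^ 2 + 2 * Eq * x := by
    rw [hEp2, hEq2, hexp, hx]; field_simp; ring
  have hpos : 0 < Eq + x := by
    -- `2Eq(Eq + x) = 2Eq² + 2⟨q,p−q⟩ + ‖p−q‖² ≥ 2Eq² − 2‖q‖‖p−q‖ + ‖p−q‖² ≥ Eq² + (‖q‖ − ‖p−q‖)² > 0`
    have hcs : |inner ℝ q (p - q)| ≤ ‖q‖ * ‖p - q‖ := abs_real_inner_le_norm _ _
    have h2 : 2 * Eq * (Eq + x) = 2 * Eq ^ 2 + 2 * inner ℝ q (p - q) + ‖p - q‖ ^ 2 := by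
      rw [hx]; field_simp; ring
    have h3 : 0 < 2 * Eq ^ 2 + 2 * inner ℝ q (p - q) + ‖p - q‖ ^ 2 := by
      nlinarith [neg_abs_le (inner ℝ q (p - q)), sq_nonneg (‖q‖ - ‖p - q‖), norm_nonneg (p - q), norm_nonneg q]
    have : 0 < 2 * Eq * (Eq + x) := by rw [h2]; exact h3
    by_contra hle
    push Not at hle
    have : 2 * Eq * (Eq + x) ≤ 0 := mul_nonpos_of_nonneg_of_nonpos (by positivity) hle
    linarith
  -- conclude: `Ep² = Eq² + 2Eq x ≤ (Eq + x)²`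
  have hsq : Ep ^ 2 ≤ (Eq + x) ^ 2 := by rw [hkey]; nlinarith [sq_nonneg x]
  exact (pow_le_pow_iff_left₀ hEp0 hpos.le two_ne_zero).mp hsq


/-- Weighted Cauchy–Schwarz: `(Σ Mₗ aₗ)² ≤ (Σ Mₗ)(Σ Mₗ aₗ²)` for nonnegative weights. [folklore] -/
theorem sq_sum_mul_le_sum_mul_sum_mul_sq {ι : Type*} (s : Finset ι) (M a : ι → ℝ) (hM : ∀ i ∈ s, 0 ≤ M i) :
    (∑ l ∈ s, M l * a l) ^ 2 ≤ (∑ l ∈ s, M l) * ∑ l ∈ s, M l * a l ^ 2 := by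
  have h := Finset.sum_mul_sq_le_sq_mul_sq s (fun l ↦ √(M l)) (fun l ↦ √(M l) * a l)
  have h1 : ∀ l ∈ s, √(M l) * (√(M l) * a l) = M l * a l := fun l hl ↦ by
    rw [← mul_assoc, Real.mul_self_sqrt (hM l hl)]
  have h2 : ∀ l ∈ s, √(M l) ^ 2 = M l := fun l hl ↦ Real.sq_sqrt (hM l hl)
  have h3 : ∀ l ∈ s, (√(M l) * a l) ^ 2 = M l * a l ^ 2 := fun l hl ↦ by rw [mul_pow, Real.sq_sqrt (hM l hl)]
  rw [Finset.sum_congr rfl h1, Finset.sum_congr rfl h2, Finset.sum_congr rfl h3] at h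
  exact h

/-- **Upper energy comparison `K ≲ spread²`.** For a nonempty group with masses `Mⱼ > 0` and velocities `‖vⱼ‖ ≤ k < 1`:
`Σⱼ Mⱼγⱼ − √(M_B² + ‖Σⱼ Mⱼγⱼvⱼ‖²) ≤ (2Γ⁸/M_B) Σⱼₗ MⱼMₗ‖vⱼ − vₗ‖²`, `Γ = γ(k)`. Proof: `K = Σⱼ (E_j(pⱼ) − E_j(p̄ⱼ))` with the cold
shares `p̄ⱼ = (Mⱼ/M_B)P`; smoothness of `E_j` and `Σⱼ⟨V̂, pⱼ − p̄ⱼ⟩ = 0` give `K ≤ Σⱼ‖pⱼ − p̄ⱼ‖²/(2Mⱼ)`, and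
`pⱼ − p̄ⱼ = (Mⱼ/M_B)Σₗ Mₗ(γⱼvⱼ − γₗvₗ)` with `v ↦ γ(v)v` `2Γ⁴`-Lipschitz and weighted Cauchy–Schwarz. [folklore] -/
theorem internalEnergy_le' {ι : Type*} (s : Finset ι) (M : ι → ℝ) (v : ι → E3) {k : ℝ}
    (hM : ∀ i ∈ s, 0 < M i) (hk : k < 1) (hv : ∀ i ∈ s, ‖v i‖ ≤ k) (hs : s.Nonempty) :
    ∑ j ∈ s, M j * (√(1 - ‖v j‖ ^ 2))⁻¹ -
        √((∑ i ∈ s, M i) ^ 2 + ‖∑ i ∈ s, (M i * (√(1 - ‖v i‖ ^ 2))⁻¹) • v i‖ ^ 2) ≤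
      2 * ((√(1 - k ^ 2))⁻¹) ^ 8 / (∑ i ∈ s, M i) * ∑ j ∈ s, ∑ l ∈ s, M j * M l * ‖v j - v l‖ ^ 2 := by
  obtain ⟨i₀, hi₀⟩ := hs
  have hk0 : 0 ≤ k := (norm_nonneg _).trans (hv i₀ hi₀)
  set MB : ℝ := ∑ i ∈ s, M i with hMB
  have hMB0 : 0 < MB := Finset.sum_pos hM ⟨i₀, hi₀⟩
  set Γ : ℝ := (√(1 - k ^ 2))⁻¹ with hΓ
  have hk2 : 0 < 1 - k ^ 2 := by nlinarith
  have hΓ0 : 0 < Γ := inv_pos.mpr (Real.sqrt_pos.mpr hk2)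
  have hv1 : ∀ i ∈ s, ‖v i‖ < 1 := fun i hi ↦ (hv i hi).trans_lt hk
  -- momenta, total, cold shares, cold energy
  set p : ι → E3 := fun j ↦ (M j * (√(1 - ‖v j‖ ^ 2))⁻¹) • v j with hp
  set P : E3 := ∑ i ∈ s, p i with hP
  set S : ℝ := √(MB ^ 2 + ‖P‖ ^ 2) with hS
  have hS0 : 0 < S := Real.sqrt_pos.mpr (by positivity)
  set pbar : ι → E3 := fun j ↦ (M j / MB) • P with hpbar
  -- (1) energies of the members
  have hE : ∀ j ∈ s, √(M j ^ 2 + ‖p j‖ ^ 2) = M j * (√(1 - ‖v j‖ ^ 2))⁻¹ := fun j hj ↦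
    sqrt_sq_add_norm_lorentzMomentum (hM j hj).le (hv1 j hj)
  -- (2) energies of the cold shares sum to `S`
  have hEbar : ∀ j ∈ s, √(M j ^ 2 + ‖pbar j‖ ^ 2) = M j / MB * S := fun j hj ↦
    sqrt_sq_add_norm_coldShare (hM j hj) hMB0 P
  have hsumEbar : ∑ j ∈ s, √(M j ^ 2 + ‖pbar j‖ ^ 2) = S := by
    rw [Finset.sum_congr rfl hEbar, ← Finset.sum_mul, ← Finset.sum_div, ← hMB, div_self hMB0.ne', one_mul]
  -- rewrite `K` as a sum of member deficits
  have hK : ∑ j ∈ s, M j * (√(1 - ‖v j‖ ^ 2))⁻¹ - S =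
      ∑ j ∈ s, (√(M j ^ 2 + ‖p j‖ ^ 2) - √(M j ^ 2 + ‖pbar j‖ ^ 2)) := by
    rw [Finset.sum_sub_distrib, hsumEbar, Finset.sum_congr rfl hE]
  rw [hK]
  -- (3) smoothness per member, with the common gradient `V̂ = S⁻¹ P`
  have hgrad : ∀ j ∈ s, (√(M j ^ 2 + ‖pbar j‖ ^ 2))⁻¹ • pbar j = S⁻¹ • P := by
    intro j hj
    rw [hEbar j hj, hpbar]
    dsimp only
    rw [smul_smul]
    congr 1
    have hr : 0 < M j / MB := div_pos (hM j hj) hMB0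
    have hMj : M j ≠ 0 := (hM j hj).ne'
    field_simp
  have hsm : ∀ j ∈ s, √(M j ^ 2 + ‖p j‖ ^ 2) - √(M j ^ 2 + ‖pbar j‖ ^ 2) ≤
      inner ℝ (S⁻¹ • P) (p j - pbar j) + ‖p j - pbar j‖ ^ 2 / (2 * M j) := by
    intro j hj
    have h := energy_smoothness (hM j hj).ne' (p j) (pbar j)
    rw [hgrad j hj] at h
    have hEj : M j ≤ √(M j ^ 2 + ‖pbar j‖ ^ 2) :=
      calc M j = √(M j ^ 2) := (Real.sqrt_sq (hM j hj).le).symm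
        _ ≤ √(M j ^ 2 + ‖pbar j‖ ^ 2) := Real.sqrt_le_sqrt (by nlinarith [norm_nonneg (pbar j)])
    have hden : ‖p j - pbar j‖ ^ 2 / (2 * √(M j ^ 2 + ‖pbar j‖ ^ 2)) ≤ ‖p j - pbar j‖ ^ 2 / (2 * M j) := by
      apply div_le_div_of_nonneg_left (by positivity) (by linarith [hM j hj]) (by linarith)
    linarith
  -- (4) the gradient terms cancel
  have hcancel : ∑ j ∈ s, inner ℝ (S⁻¹ • P) (p j - pbar j) = 0 := by
    rw [← inner_sum, Finset.sum_sub_distrib]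
    have : ∑ j ∈ s, pbar j = P := by
      rw [hpbar]
      dsimp only
      rw [← Finset.sum_smul, ← Finset.sum_div, ← hMB, div_self hMB0.ne', one_smul]
    rw [this, ← hP, sub_self, inner_zero_right]
  -- (5) deficit of member `j`
  have hdiff : ∀ j ∈ s, p j - pbar j = (M j / MB) • ∑ l ∈ s, M l • ((√(1 - ‖v j‖ ^ 2))⁻¹ • v j - (√(1 - ‖v l‖ ^ 2))⁻¹ • v l) := by
    intro j hj
    have h1 : ∑ l ∈ s, M l • ((√(1 - ‖v j‖ ^ 2))⁻¹ • v j - (√(1 - ‖v l‖ ^ 2))⁻¹ • v l) =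
        MB • ((√(1 - ‖v j‖ ^ 2))⁻¹ • v j) - P := by
      simp_rw [smul_sub]
      rw [Finset.sum_sub_distrib, ← Finset.sum_smul, ← hMB]
      congr 1
      rw [hP, hp]
      refine Finset.sum_congr rfl fun l _ ↦ ?_
      rw [smul_smul]
    rw [h1, smul_sub, smul_smul, div_mul_cancel₀ _ hMB0.ne', hp, hpbar]
    dsimp only
    rw [smul_smul]
  have hnorm : ∀ j ∈ s, ‖p j - pbar j‖ ≤ M j / MB * ∑ l ∈ s, M l * (2 * Γ ^ 4 * ‖v j - v l‖) := by
    intro j hj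
    rw [hdiff j hj, norm_smul, Real.norm_eq_abs, abs_of_pos (div_pos (hM j hj) hMB0)]
    refine mul_le_mul_of_nonneg_left ((norm_sum_le _ _).trans (Finset.sum_le_sum fun l hl ↦ ?_))
      (div_pos (hM j hj) hMB0).le
    rw [norm_smul, Real.norm_eq_abs, abs_of_pos (hM l hl)]
    exact mul_le_mul_of_nonneg_left (norm_lorentzMomentum_sub_le hk (hv j hj) (hv l hl)) (hM l hl).le
  have hsq : ∀ j ∈ s, ‖p j - pbar j‖ ^ 2 / (2 * M j) ≤ 2 * Γ ^ 8 / MB * ∑ l ∈ s, M j * M l * ‖v j - v l‖ ^ 2 := by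
    intro j hj
    have hMj := hM j hj
    have h1 := hnorm j hj
    have hcs := sq_sum_mul_le_sum_mul_sum_mul_sq s M (fun l ↦ ‖v j - v l‖) fun l hl ↦ (hM l hl).le
    have hfac : ∑ l ∈ s, M l * (2 * Γ ^ 4 * ‖v j - v l‖) = 2 * Γ ^ 4 * ∑ l ∈ s, M l * ‖v j - v l‖ := by
      rw [Finset.mul_sum]; refine Finset.sum_congr rfl fun l _ ↦ ?_; ring
    rw [hfac] at h1
    have h0 : 0 ≤ ‖p j - pbar j‖ := norm_nonneg _
    have h2 : ‖p j - pbar j‖ ^ 2 ≤ (M j / MB * (2 * Γ ^ 4 * ∑ l ∈ s, M l * ‖v j - v l‖)) ^ 2 :=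
      pow_le_pow_left₀ h0 h1 2
    have hsum0 : 0 ≤ ∑ l ∈ s, M l * ‖v j - v l‖ := Finset.sum_nonneg fun l hl ↦ by positivity [(hM l hl).le]
    have hfac2 : ∑ l ∈ s, M j * M l * ‖v j - v l‖ ^ 2 = M j * ∑ l ∈ s, M l * ‖v j - v l‖ ^ 2 := by
      rw [Finset.mul_sum]; refine Finset.sum_congr rfl fun l _ ↦ ?_; ring
    rw [hfac2, div_le_iff₀ (by positivity)]
    rw [← hMB] at hcs
    -- `‖p−p̄‖² ≤ (Mj/MB)² 4Γ⁸ (Σ Mₗ aₗ)² ≤ (Mj/MB)² 4Γ⁸ MB Σ Mₗ aₗ²`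
    have h3 : (M j / MB * (2 * Γ ^ 4 * ∑ l ∈ s, M l * ‖v j - v l‖)) ^ 2 =
        (M j / MB) ^ 2 * (4 * Γ ^ 8) * (∑ l ∈ s, M l * ‖v j - v l‖) ^ 2 := by ring
    rw [h3] at h2
    have h4 : (M j / MB) ^ 2 * (4 * Γ ^ 8) * (∑ l ∈ s, M l * ‖v j - v l‖) ^ 2 ≤
        (M j / MB) ^ 2 * (4 * Γ ^ 8) * (MB * ∑ l ∈ s, M l * ‖v j - v l‖ ^ 2) :=
      mul_le_mul_of_nonneg_left hcs (by positivity)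
    have h5 : (M j / MB) ^ 2 * (4 * Γ ^ 8) * (MB * ∑ l ∈ s, M l * ‖v j - v l‖ ^ 2) =
        2 * Γ ^ 8 / MB * (M j * ∑ l ∈ s, M l * ‖v j - v l‖ ^ 2) * (2 * M j) := by
      field_simp; ring
    linarith
  -- (6) assemble
  calc ∑ j ∈ s, (√(M j ^ 2 + ‖p j‖ ^ 2) - √(M j ^ 2 + ‖pbar j‖ ^ 2))
      ≤ ∑ j ∈ s, (inner ℝ (S⁻¹ • P) (p j - pbar j) + ‖p j - pbar j‖ ^ 2 / (2 * M j)) := Finset.sum_le_sum hsm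
    _ = ∑ j ∈ s, ‖p j - pbar j‖ ^ 2 / (2 * M j) := by rw [Finset.sum_add_distrib, hcancel, zero_add]
    _ ≤ ∑ j ∈ s, 2 * Γ ^ 8 / MB * ∑ l ∈ s, M j * M l * ‖v j - v l‖ ^ 2 := Finset.sum_le_sum hsq
    _ = 2 * Γ ^ 8 / MB * ∑ j ∈ s, ∑ l ∈ s, M j * M l * ‖v j - v l‖ ^ 2 := by rw [← Finset.mul_sum]

/-- Registered one-line form of `internalEnergy_le'` (upper energy comparison `K ≲ spread²`). [folklore] -/
theorem internalEnergy_le : open Literature.Geometry.Lorentzian Finset in ∀ {ι : Type*} (s : Finset ι) (M : ι → ℝ) (v : ι → E3) {k : ℝ}, (∀ i ∈ s, 0 < M i) → k < 1 → (∀ i ∈ s, ‖v i‖ ≤ k) → s.Nonempty → ∑ j ∈ s, M j * (√(1 - ‖v j‖ ^ 2))⁻¹ - √((∑ i ∈ s, M i) ^ 2 + ‖∑ i ∈ s, (M i * (√(1 - ‖v i‖ ^ 2))⁻¹) • v i‖ ^ 2) ≤ 2 * ((√(1 - k ^ 2))⁻¹) ^ 8 / (∑ i ∈ s, M i) * ∑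 j ∈ s, ∑ l ∈ s, M j * M l * ‖v j - v l‖ ^ 2 :=
  fun s M v _ hM hk hv hs ↦ internalEnergy_le' s M v hM hk hv hs

end Summit.FinalStateConjecture.FinalStateConjecture.Theorems.SublinearIsFree.Virial

end
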